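import Literature.NumberTheory.LFunctions.XiMoments
import Literature.NumberTheory.LFunctions.XiKernelLaplace
import HarnessLib

/-!
# Concentration of the moment measures `Φ(u) uᵏ du` — proved

Trunk T-ANT (`Literature/NumberTheory/LFunctions`). The one genuinely analytic input to the
Griffin–Ono–Rolen–Zagier theorem "`J^{d,n}_γ` is hyperbolic for `n ≫_d 1`" (PNAS 116 (2019),
Thm. 1 = `Literature.NumberTheory.LFunctions.gorz_eventually`), in the moment formulation: by `XiMoments.lean`,
`γ(n) = 64·4ⁿ n!/(2n)! · M_{2n}` with `M_k = ∫₀^∞ Φ(u) uᵏ du`, so that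
`γ(n+j)/γ(n) = ∏_{i<j} (n+i+1/2)⁻¹ · M_{2n+2j}/M_{2n}`, and the shape of `log(γ(n+j)/γ(n))`
required by GORZ Thm. 3 / §5.1 eq. (15) follows (in `JensenAsymptotics.lean`) from the decay of
the normalised central moments of the probability measures `ν_k ∝ Φ(u) uᵏ du` proved here.
GORZ obtain (15) instead from the all-orders saddle-point expansion of Thm. 7 (§4); the present
route needs only the crude Laplace bounds of `XiKernelLaplace.lean`.

Write `ū_k = M_{k+1}/M_k` for the mean of `ν_k` and `m_l(k) = E_{ν_k}[(u/ū_k - 1)^l]` for its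
normalised central moments (`m_0 = 1`, `m_1 = 0`). With `a_k`, `λ_k` the saddle point and
curvature scale of `u^k e^{ψ(u)}` (`XiKernelLaplace.lean`) and `c₀ e^{ψ} ≤ Φ ≤ C₀ e^{ψ}`:
`∫ Φ uᵏ |u - a_k|^l ≤ K_l λ_k^{-l/2} M_k`, hence `|ū_k - a_k| ≤ K_1 λ_k^{-1/2}`, `ū_k ≥ a_k/2`,
`|m_l(k)| ≤ K'_l (√λ_k ū_k)^{-l}`, and finally, since `λ_k ≥ k/a_k` and `a_k → ∞`,
`m_l(k) = o(k^{-l/2})` for every `l ≥ 1`.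

## Contents (all proved)

* `deBruijnPhi_ge_exp`, `deBruijnPhi_le_phiUpper`: `(2π² - 3π) e^{ψ(u)} ≤ Φ(u) ≤ C₀ e^{ψ(u)}` on
  `[0, ∞)` (`C₀ = Literature.phiUpper`), from `deBruijnPhiSummand_pos` / `abs_deBruijnPhi_le`.
* `Literature.xiAbsMoment k l a = ∫₀^∞ Φ(u) uᵏ |u - a|^l du`; `Literature.NumberTheory.LFunctions.xiSaddle`, `Literature.NumberTheory.LFunctions.xiLam` (`a_k`, `λ_k`);
  `exists_xiAbsMoment_le`: `xiAbsMoment k l a_k ≤ K_l λ_k^{-l/2} M_k` eventually.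
* `Literature.xiMean k = ū_k`, `Literature.xiCM k l = m_l(k)`; `xiCM_zero`, `xiCM_one`;
  `xiMoment_add_div`: `M_{k+r}/M_k = ū_k^r ∑_{l ≤ r} C(r,l) m_l(k)` (binomial expansion).
* `abs_xiMean_sub_le`, `xiAbsMoment_le_of_centre`, `abs_xiCM_le`,
  `eventually_xiSaddle_le_two_mul_xiMean`, `exists_abs_xiCM_le`, and the export
  `Literature.isLittleO_xiCM : (m_l(k))_k = o(k^{-l/2})` (`l ≥ 1`).

## References

* M. Griffin, K. Ono, L. Rolen, D. Zagier, *Jensen polynomials for the Riemann zeta function and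
  other sequences*, PNAS 116 (2019) 11103–11110, Thm. 7, §4 and §5.1 (eqs. (15)–(18)).
  [GORZPNAS2019]
* E. C. Titchmarsh, *The Theory of the Riemann Zeta-Function*, 2nd ed. (1986), §10.1
  (`Ξ(t) = 2∫₀^∞ Φ(u) cos(ut) du`, all terms of `Φ` positive). [Titchmarsh1986]
-/

noncomputable section

open Real MeasureTheory Set Filter Topology Asymptotics
open scoped Nat

namespace Literature.NumberTheory.LFunctions

/-! ### Two-sided comparison `c₀ e^{ψ} ≤ Φ ≤ C₀ e^{ψ}` on `[0, ∞)` -/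

/-- `Φ(u) ≥ (2π² - 3π) e^{9u - π e^{4u}}` for `u ≥ 0` (the `n = 1` term alone, all terms being
positive). [folklore] -/
theorem deBruijnPhi_ge_exp {u : ℝ} (hu : 0 ≤ u) :
    (2 * π ^ 2 - 3 * π) * exp (XiKernel.psi u) ≤ deBruijnPhi u := by
  have hsum := summable_deBruijnPhi_holds u
  have h0 : deBruijnPhiSummand 0 u ≤ deBruijnPhi u := by
    rw [deBruijnPhi]
    exact hsum.le_tsum 0 fun j _ ↦ (deBruijnPhiSummand_pos j hu).le
  refine le_trans ?_ h0
  rw [deBruijnPhiSummand, XiKernel.psi]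
  have h4 : exp (5 * u) ≤ exp (9 * u) := exp_le_exp.2 (by linarith)
  have hexp : exp (9 * u - π * exp (4 * u)) = exp (9 * u) * exp (-(π * exp (4 * u))) := by
    rw [← exp_add]; ring_nf
  rw [hexp]
  push_cast
  simp only [zero_add, one_pow, mul_one]
  have hπ : 0 < π := pi_pos
  nlinarith [exp_pos (9 * u), exp_pos (-(π * (1:ℝ) ^ 2 * exp (4 * u))), mul_pos hπ (exp_pos (5*u)),
    mul_le_mul_of_nonneg_left h4 (by positivity : (0:ℝ) ≤ 3 * π),
    exp_pos (-(π * exp (4 * u)))]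

/-- The constant `C₀ = max 1 (∑ majorants)` of the upper bound `Φ ≤ C₀ e^{ψ}` on `[0, ∞)`.
[folklore] -/
def phiUpper : ℝ := max 1 (∑' n, deBruijnPhiMajorant n)

/-- `C₀ > 0`. [folklore] -/
theorem phiUpper_pos : 0 < phiUpper := lt_of_lt_of_le one_pos (le_max_left _ _)

/-- `Φ(u) ≤ C₀ e^{ψ(u)}` for `u ≥ 0`. [folklore] -/
theorem deBruijnPhi_le_phiUpper {u : ℝ} (hu : 0 ≤ u) :
    deBruijnPhi u ≤ phiUpper * exp (XiKernel.psi u) := by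
  have h := (le_abs_self _).trans (abs_deBruijnPhi_le hu)
  refine h.trans ?_
  rw [XiKernel.psi]
  gcongr
  exact le_max_right _ _

/-! ### Weighted integrals `∫ Φ(u) u^k g(u) du` -/

/-- `(u + b)^l ≤ 2^l (u^l + b^l)` for `u, b ≥ 0`. [folklore] -/
theorem add_pow_le_two_pow {u b : ℝ} (hu : 0 ≤ u) (hb : 0 ≤ b) (l : ℕ) :
    (u + b) ^ l ≤ 2 ^ l * (u ^ l + b ^ l) := by
  have h1 : u + b ≤ 2 * max u b := by
    rcases le_total u b with h | h
    · rw [max_eq_right h]; linarith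
    · rw [max_eq_left h]; linarith
  have h2 : (max u b) ^ l ≤ u ^ l + b ^ l := by
    rcases le_total u b with h | h
    · rw [max_eq_right h]; linarith [pow_nonneg hu l]
    · rw [max_eq_left h]; linarith [pow_nonneg hb l]
  calc (u + b) ^ l ≤ (2 * max u b) ^ l := pow_le_pow_left₀ (by positivity) h1 l
    _ = 2 ^ l * (max u b) ^ l := mul_pow _ _ _
    _ ≤ 2 ^ l * (u ^ l + b ^ l) := by gcongr

/-- Integrability of `Φ(u) u^k g(u)` on `(0, ∞)` for continuous `g` of polynomial growth.
[folklore] -/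
theorem integrableOn_deBruijnPhi_mul_pow_mul {g : ℝ → ℝ} (hg : Continuous g) {A : ℝ} {m : ℕ}
    (hbound : ∀ u, 0 ≤ u → |g u| ≤ A * (1 + u ^ m)) (k : ℕ) :
    IntegrableOn (fun u ↦ deBruijnPhi u * u ^ k * g u) (Ioi 0) := by
  have hint : IntegrableOn (fun u ↦ |A| * (deBruijnPhi u * u ^ k + deBruijnPhi u * u ^ (k + m)))
      (Ioi 0) :=
    ((integrableOn_deBruijnPhi_mul_pow k).add
      (integrableOn_deBruijnPhi_mul_pow (k + m))).const_mul _
  refine hint.mono' ?_ (ae_restrict_of_forall_mem measurableSet_Ioi fun u hu ↦ ?_)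
  · exact ((continuous_deBruijnPhi_mul_pow k).mul hg).aestronglyMeasurable.restrict
  · have hu' : (0 : ℝ) ≤ u := le_of_lt hu
    have hΦ : 0 ≤ deBruijnPhi u := (deBruijnPhi_pos_of_nonneg hu').le
    rw [Real.norm_eq_abs, abs_mul, abs_of_nonneg (by positivity : 0 ≤ deBruijnPhi u * u ^ k)]
    have hA : A ≤ |A| := le_abs_self A
    calc deBruijnPhi u * u ^ k * |g u| ≤ deBruijnPhi u * u ^ k * (A * (1 + u ^ m)) := by
          gcongr; exact hbound u hu'
      _ ≤ deBruijnPhi u * u ^ k * (|A| * (1 + u ^ m)) := by gcongr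
      _ = |A| * (deBruijnPhi u * u ^ k + deBruijnPhi u * u ^ (k + m)) := by ring

/-- Integrability of `Φ(u) u^k |u - a|^l`. [folklore] -/
theorem integrableOn_deBruijnPhi_mul_pow_mul_abs_pow (k l : ℕ) (a : ℝ) :
    IntegrableOn (fun u ↦ deBruijnPhi u * u ^ k * |u - a| ^ l) (Ioi 0) := by
  refine integrableOn_deBruijnPhi_mul_pow_mul (by fun_prop) (A := 2 ^ l * (1 + |a| ^ l)) (m := l)
    (fun u hu ↦ ?_) k
  rw [abs_pow, abs_abs]
  calc |u - a| ^ l ≤ (u + |a|) ^ l := by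
        apply pow_le_pow_left₀ (abs_nonneg _)
        calc |u - a| ≤ |u| + |a| := abs_sub u a
          _ = u + |a| := by rw [abs_of_nonneg hu]
    _ ≤ 2 ^ l * (u ^ l + |a| ^ l) := add_pow_le_two_pow hu (abs_nonneg a) l
    _ ≤ 2 ^ l * (1 + |a| ^ l) * (1 + u ^ l) := by
        have h1 : 0 ≤ u ^ l := pow_nonneg hu l
        have h2 : 0 ≤ |a| ^ l := pow_nonneg (abs_nonneg a) l
        nlinarith [mul_nonneg h1 h2, pow_nonneg (by norm_num : (0:ℝ) ≤ 2) l,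
          mul_nonneg (pow_nonneg (by norm_num : (0:ℝ) ≤ 2) l) (mul_nonneg h1 h2)]

/-- Integrability of `Φ(u) u^k (u - a)^l`. [folklore] -/
theorem integrableOn_deBruijnPhi_mul_pow_mul_sub_pow (k l : ℕ) (a : ℝ) :
    IntegrableOn (fun u ↦ deBruijnPhi u * u ^ k * (u - a) ^ l) (Ioi 0) := by
  have h := integrableOn_deBruijnPhi_mul_pow_mul_abs_pow k l a
  refine h.congr' ?_ ?_  -- same norm
  · exact ((continuous_deBruijnPhi_mul_pow k).mul (by fun_prop)).aestronglyMeasurable.restrict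
  · exact ae_restrict_of_forall_mem measurableSet_Ioi fun u hu ↦ by
      simp

/-! ### The moment bound about the saddle point -/

/-- `∫₀^∞ Φ(u) u^k |u - a|^l du`, the un-normalised `l`-th absolute moment about `a` of the
measure `Φ(u) u^k du`. [folklore] -/
def xiAbsMoment (k l : ℕ) (a : ℝ) : ℝ := ∫ u in Ioi 0, deBruijnPhi u * u ^ k * |u - a| ^ l

/-- The saddle point `a_k` of `u^k e^{ψ(u)}` (`XiKernelLaplace.lean`). [folklore] -/
def xiSaddle (k : ℕ) : ℝ := XiKernel.saddle k

/-- The curvature scale `λ_k = k/a_k + 9`. [folklore] -/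
def xiLam (k : ℕ) : ℝ := XiKernel.lam k

/-- `a_k > 0`. [folklore] -/
theorem xiSaddle_pos (k : ℕ) : 0 < xiSaddle k := XiKernel.saddle_pos _

/-- `a_k → ∞`. [folklore] -/
theorem tendsto_xiSaddle_atTop : Tendsto xiSaddle atTop atTop :=
  XiKernel.tendsto_saddle_atTop.comp tendsto_natCast_atTop_atTop

/-- `λ_k → ∞`. [folklore] -/
theorem tendsto_xiLam_atTop : Tendsto xiLam atTop atTop :=
  XiKernel.tendsto_lam_atTop.comp tendsto_natCast_atTop_atTop

/-- `k/a_k ≤ λ_k`. [folklore] -/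
theorem div_xiSaddle_le_xiLam (k : ℕ) : (k : ℝ) / xiSaddle k ≤ xiLam k :=
  XiKernel.div_saddle_le_lam _

/-- Eventually `a_k ≥ 1` and `(2/5) λ_k ≥ 1` (and `k ≥ 1`). [folklore] -/
theorem eventually_saddle_lam :
    ∀ᶠ k : ℕ in atTop, 1 ≤ k ∧ 1 ≤ xiSaddle k ∧ 1 ≤ 2 / 5 * xiLam k := by
  filter_upwards [eventually_ge_atTop 1, tendsto_xiSaddle_atTop.eventually_ge_atTop 1,
    tendsto_xiLam_atTop.eventually_ge_atTop (5 / 2)] with k h1 h2 h3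
  exact ⟨h1, h2, by linarith⟩

/-- On `(0, ∞)`: `u^k e^{ψ(u)} = e^{H_k(a)} · e^{H_k(u) - H_k(a)}`. [folklore] -/
theorem pow_mul_exp_psi (k : ℕ) (a : ℝ) {u : ℝ} (hu : 0 < u) :
    u ^ k * exp (XiKernel.psi u) =
      exp (XiKernel.H k a) * exp (XiKernel.H k u - XiKernel.H k a) := by
  rw [← exp_add, add_sub_cancel, XiKernel.exp_H hu, rpow_natCast]

/-- **The moment bound**: for every `l` there is `K_l` with
`∫₀^∞ Φ(u) u^k |u - a_k|^l du ≤ K_l λ_k^{-l/2} ∫₀^∞ Φ(u) u^k du` for all large `k`. [folklore] -/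
theorem exists_xiAbsMoment_le (l : ℕ) : ∃ K : ℝ, 0 < K ∧ ∀ᶠ k : ℕ in atTop,
    xiAbsMoment k l (xiSaddle k) ≤ K / sqrt (xiLam k) ^ l * xiMoment k := by
  obtain ⟨C, hC, hbound⟩ := XiKernel.exists_moment_bound l
  set c₀ : ℝ := 2 * π ^ 2 - 3 * π with hc₀
  have hc₀pos : 0 < c₀ := by
    have := pi_gt_three; rw [hc₀]; nlinarith
  refine ⟨phiUpper * C / c₀, by have := phiUpper_pos; positivity, ?_⟩
  filter_upwards [eventually_saddle_lam] with k hk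
  obtain ⟨hk1, ha, hc⟩ := hk
  have hs : (0 : ℝ) < k := by exact_mod_cast hk1
  set a := xiSaddle k with hadef
  have haS : XiKernel.saddle (k : ℝ) = a := rfl
  have hlS : XiKernel.lam (k : ℝ) = xiLam k := rfl
  have hkey := hbound k hs ha hc
  rw [haS, hlS] at hkey
  set W : ℝ → ℝ := fun u ↦ exp (XiKernel.H k u - XiKernel.H k a) with hW
  set E : ℝ := exp (XiKernel.H k a) with hE
  have hEpos : 0 < E := exp_pos _
  have hsl : 0 < sqrt (xiLam k) := sqrt_pos.2 (by linarith)
  -- integrability facts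
  have hI1 : IntegrableOn (fun u ↦ |u - a| ^ l * W u) (Ioi 0) := by
    have := XiKernel.integrableOn_abs_pow_mul_expH hs hc l; rwa [haS] at this
  have hI0 : IntegrableOn W (Ioi 0) := by
    have := XiKernel.integrableOn_expH hs hc; rwa [haS] at this
  -- step 1: Φ u^k |u-a|^l ≤ C₀ E |u-a|^l W
  have h1 : xiAbsMoment k l a ≤ ∫ u in Ioi 0, phiUpper * E * (|u - a| ^ l * W u) := by
    refine setIntegral_mono_on (integrableOn_deBruijnPhi_mul_pow_mul_abs_pow k l a)
      ((hI1.const_mul _)) measurableSet_Ioi fun u hu ↦ ?_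
    have hu' : (0:ℝ) ≤ u := le_of_lt hu
    calc deBruijnPhi u * u ^ k * |u - a| ^ l
        ≤ phiUpper * exp (XiKernel.psi u) * u ^ k * |u - a| ^ l := by
          gcongr; exact deBruijnPhi_le_phiUpper hu'
      _ = phiUpper * E * (|u - a| ^ l * W u) := by
          rw [hW, hE]; simp only
          rw [mul_assoc phiUpper (exp _) (u ^ k), mul_comm (exp (XiKernel.psi u)) (u ^ k),
            pow_mul_exp_psi k a hu]
          ring
  -- step 2: Laplace bound
  have h2 : ∫ u in Ioi 0, phiUpper * E * (|u - a| ^ l * W u) ≤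
      phiUpper * E * (C / sqrt (xiLam k) ^ l * ∫ u in Ioi 0, W u) := by
    rw [integral_const_mul]
    exact mul_le_mul_of_nonneg_left hkey (by have := phiUpper_pos; positivity)
  -- step 3: E ∫ W = ∫ u^k e^ψ ≤ (1/c₀) ∫ Φ u^k
  have h3 : E * ∫ u in Ioi 0, W u ≤ (1 / c₀) * xiMoment k := by
    rw [← integral_const_mul, xiMoment, ← integral_const_mul]
    refine setIntegral_mono_on (hI0.const_mul _) ((integrableOn_deBruijnPhi_mul_pow k).const_mul _)
      measurableSet_Ioi fun u hu ↦ ?_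
    have hu' : (0:ℝ) ≤ u := le_of_lt hu
    rw [hW, hE]; simp only
    rw [← pow_mul_exp_psi k a hu]
    have := deBruijnPhi_ge_exp hu'
    rw [← hc₀] at this
    calc u ^ k * exp (XiKernel.psi u) = (1 / c₀) * (c₀ * exp (XiKernel.psi u)) * u ^ k := by
          field_simp
      _ ≤ (1 / c₀) * deBruijnPhi u * u ^ k := by gcongr
      _ = 1 / c₀ * (deBruijnPhi u * u ^ k) := by ring
  calc xiAbsMoment k l a ≤ ∫ u in Ioi 0, phiUpper * E * (|u - a| ^ l * W u) := h1
    _ ≤ phiUpper * E * (C / sqrt (xiLam k) ^ l * ∫ u in Ioi 0, W u) := h2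
    _ = phiUpper * C / sqrt (xiLam k) ^ l * (E * ∫ u in Ioi 0, W u) := by ring
    _ ≤ phiUpper * C / sqrt (xiLam k) ^ l * ((1 / c₀) * xiMoment k) := by
        gcongr; have := phiUpper_pos; positivity
    _ = phiUpper * C / c₀ / sqrt (xiLam k) ^ l * xiMoment k := by ring

/-! ### Mean, central moments, and their decay -/

/-- The mean `ū_k = M_{k+1}/M_k` of the probability measure `ν_k ∝ Φ(u) u^k du`. [folklore] -/
def xiMean (k : ℕ) : ℝ := xiMoment (k + 1) / xiMoment k

/-- `ū_k > 0`. [folklore] -/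
theorem xiMean_pos (k : ℕ) : 0 < xiMean k := div_pos (xiMoment_pos _) (xiMoment_pos _)

/-- The normalised central moments `m_l(k) = E_{ν_k}[(u/ū_k - 1)^l]`. [folklore] -/
def xiCM (k l : ℕ) : ℝ :=
  (∫ u in Ioi 0, deBruijnPhi u * u ^ k * (u / xiMean k - 1) ^ l) / xiMoment k

/-- Integrability of `Φ(u) u^k (u/ū - 1)^l`. [folklore] -/
theorem integrableOn_xiCM_integrand (k l : ℕ) :
    IntegrableOn (fun u ↦ deBruijnPhi u * u ^ k * (u / xiMean k - 1) ^ l) (Ioi 0) := by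
  have hū := (xiMean_pos k).ne'
  have h : IntegrableOn (fun u ↦ (xiMean k)⁻¹ ^ l * (deBruijnPhi u * u ^ k * (u - xiMean k) ^ l))
      (Ioi 0) :=
    (integrableOn_deBruijnPhi_mul_pow_mul_sub_pow k l (xiMean k)).const_mul ((xiMean k)⁻¹ ^ l)
  refine h.congr_fun (fun u _ ↦ ?_) measurableSet_Ioi
  have : u / xiMean k - 1 = (xiMean k)⁻¹ * (u - xiMean k) := by field_simp
  simp only
  rw [this, mul_pow]; ring

/-- `m_0(k) = 1` (total mass). [folklore] -/
theorem xiCM_zero (k : ℕ) : xiCM k 0 = 1 := by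
  rw [xiCM]; simp only [pow_zero, mul_one]
  rw [← xiMoment]; exact div_self (xiMoment_pos k).ne'

/-- `m_1(k) = 0` (the first central moment about the mean vanishes). [folklore] -/
theorem xiCM_one (k : ℕ) : xiCM k 1 = 0 := by
  have hū := (xiMean_pos k).ne'
  have hM := (xiMoment_pos k).ne'
  have hM1 := (xiMoment_pos (k + 1)).ne'
  have h1 : (fun u : ℝ ↦ deBruijnPhi u * u ^ k * (u / xiMean k - 1) ^ 1) =
      fun u ↦ (xiMean k)⁻¹ * (deBruijnPhi u * u ^ (k + 1)) - deBruijnPhi u * u ^ k := by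
    funext u; rw [pow_one, pow_succ]; field_simp
  rw [xiCM, h1, integral_sub ((integrableOn_deBruijnPhi_mul_pow (k + 1)).const_mul _)
    (integrableOn_deBruijnPhi_mul_pow k), integral_const_mul, ← xiMoment, ← xiMoment, xiMean]
  field_simp; ring

/-- **The moments as a binomial sum of central moments**:
`M_{k+r}/M_k = ū_k^r ∑_{l ≤ r} C(r,l) m_l(k)`. [folklore] -/
theorem xiMoment_add_div (k r : ℕ) :
    xiMoment (k + r) / xiMoment k =
      xiMean k ^ r * ∑ l ∈ Finset.range (r + 1), (r.choose l : ℝ) * xiCM k l := by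
  have hū := (xiMean_pos k).ne'
  have hM := (xiMoment_pos k).ne'
  have hpt : ∀ u : ℝ, deBruijnPhi u * u ^ (k + r) = xiMean k ^ r *
      ∑ l ∈ Finset.range (r + 1),
        (r.choose l : ℝ) * (deBruijnPhi u * u ^ k * (u / xiMean k - 1) ^ l) := by
    intro u
    have hexp : u ^ r = xiMean k ^ r *
        ∑ l ∈ Finset.range (r + 1), (u / xiMean k - 1) ^ l * (r.choose l : ℝ) := by
      have hu : u = xiMean k * ((u / xiMean k - 1) + 1) := by field_simp; ring
      conv_lhs => rw [hu]
      rw [mul_pow, add_pow]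
      congr 1
      refine Finset.sum_congr rfl fun l _ ↦ ?_
      rw [one_pow, mul_one]
    rw [pow_add, hexp]
    simp only [Finset.mul_sum]
    refine Finset.sum_congr rfl fun l _ ↦ ?_
    ring
  rw [xiMoment, show (fun u ↦ deBruijnPhi u * u ^ (k + r)) = fun u ↦ xiMean k ^ r *
      ∑ l ∈ Finset.range (r + 1),
        (r.choose l : ℝ) * (deBruijnPhi u * u ^ k * (u / xiMean k - 1) ^ l)
      from funext hpt, integral_const_mul, integral_finsetSum]
  · rw [mul_div_assoc, Finset.sum_div]
    congr 1
    refine Finset.sum_congr rfl fun l _ ↦ ?_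
    rw [integral_const_mul, xiCM]; ring
  · intro l _
    exact (integrableOn_xiCM_integrand k l).const_mul _

/-- `|ū_k - a| ≤ (∫ Φ u^k |u - a|)/M_k` for any `a`. [folklore] -/
theorem abs_xiMean_sub_le (k : ℕ) (a : ℝ) :
    |xiMean k - a| ≤ xiAbsMoment k 1 a / xiMoment k := by
  have hM := xiMoment_pos k
  have h1 : xiMean k - a = (∫ u in Ioi 0, deBruijnPhi u * u ^ k * (u - a)) / xiMoment k := by
    rw [eq_div_iff hM.ne', sub_mul, xiMean, div_mul_cancel₀ _ hM.ne']
    have : ∀ u : ℝ, deBruijnPhi u * u ^ k * (u - a) =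
        deBruijnPhi u * u ^ (k + 1) - a * (deBruijnPhi u * u ^ k) := by
      intro u; rw [pow_succ]; ring
    simp_rw [this]
    rw [integral_sub (integrableOn_deBruijnPhi_mul_pow (k + 1))
      ((integrableOn_deBruijnPhi_mul_pow k).const_mul a), integral_const_mul, xiMoment, xiMoment]
  rw [h1, abs_div, abs_of_pos hM, xiAbsMoment]
  gcongr
  refine (abs_integral_le_integral_abs).trans (le_of_eq ?_)
  refine setIntegral_congr_fun measurableSet_Ioi fun u hu ↦ ?_
  have hu' : (0:ℝ) ≤ u := le_of_lt hu
  rw [abs_mul, abs_of_nonneg (mul_nonneg (deBruijnPhi_pos_of_nonneg hu').le (pow_nonneg hu' k)),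
    pow_one]

/-- Change of centre: `∫ Φ u^k |u - b|^l ≤ 2^l (∫ Φ u^k |u - a|^l + |a - b|^l M_k)`. [folklore] -/
theorem xiAbsMoment_le_of_centre (k l : ℕ) (a b : ℝ) :
    xiAbsMoment k l b ≤ 2 ^ l * (xiAbsMoment k l a + |a - b| ^ l * xiMoment k) := by
  rw [xiAbsMoment, xiAbsMoment, xiMoment, ← integral_const_mul, ← integral_add
    (integrableOn_deBruijnPhi_mul_pow_mul_abs_pow k l a)
    ((integrableOn_deBruijnPhi_mul_pow k).const_mul _), ← integral_const_mul]
  refine setIntegral_mono_on (integrableOn_deBruijnPhi_mul_pow_mul_abs_pow k l b)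
    (((integrableOn_deBruijnPhi_mul_pow_mul_abs_pow k l a).add
      ((integrableOn_deBruijnPhi_mul_pow k).const_mul _)).const_mul _) measurableSet_Ioi
    fun u hu ↦ ?_
  have hu' : (0:ℝ) ≤ u := le_of_lt hu
  have hw : 0 ≤ deBruijnPhi u * u ^ k :=
    mul_nonneg (deBruijnPhi_pos_of_nonneg hu').le (pow_nonneg hu' k)
  have htri : |u - b| ≤ |u - a| + |a - b| := abs_sub_le u a b
  have hpow : |u - b| ^ l ≤ 2 ^ l * (|u - a| ^ l + |a - b| ^ l) :=
    (pow_le_pow_left₀ (abs_nonneg _) htri l).trans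
      (add_pow_le_two_pow (abs_nonneg _) (abs_nonneg _) l)
  calc deBruijnPhi u * u ^ k * |u - b| ^ l
      ≤ deBruijnPhi u * u ^ k * (2 ^ l * (|u - a| ^ l + |a - b| ^ l)) :=
        mul_le_mul_of_nonneg_left hpow hw
    _ = 2 ^ l * (deBruijnPhi u * u ^ k * |u - a| ^ l + |a - b| ^ l * (deBruijnPhi u * u ^ k)) := by
        ring

/-- `|m_l(k)| ≤ (∫ Φ u^k |u - ū_k|^l)/(ū_k^l M_k)`. [folklore] -/
theorem abs_xiCM_le (k l : ℕ) :
    |xiCM k l| ≤ xiAbsMoment k l (xiMean k) / (xiMean k ^ l * xiMoment k) := by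
  have hM := xiMoment_pos k
  have hū := xiMean_pos k
  rw [xiCM, abs_div, abs_of_pos hM, show xiAbsMoment k l (xiMean k) / (xiMean k ^ l * xiMoment k) =
    ((xiMean k)⁻¹ ^ l * xiAbsMoment k l (xiMean k)) / xiMoment k by
      rw [inv_pow]; field_simp]
  gcongr
  rw [xiAbsMoment, ← integral_const_mul]
  refine (abs_integral_le_integral_abs).trans (le_of_eq ?_)
  refine setIntegral_congr_fun measurableSet_Ioi fun u hu ↦ ?_
  have hu' : (0:ℝ) ≤ u := le_of_lt hu
  have hsub : u / xiMean k - 1 = (xiMean k)⁻¹ * (u - xiMean k) := by field_simp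
  rw [abs_mul, abs_of_nonneg (mul_nonneg (deBruijnPhi_pos_of_nonneg hu').le (pow_nonneg hu' k)),
    abs_pow, hsub, abs_mul, abs_of_pos (inv_pos.2 hū), mul_pow]
  ring

/-- Eventually `ū_k ≥ a_k/2` (indeed `ū_k - a_k = O(λ_k^{-1/2})`). [folklore] -/
theorem eventually_xiSaddle_le_two_mul_xiMean : ∀ᶠ k : ℕ in atTop, xiSaddle k ≤ 2 * xiMean k := by
  obtain ⟨K, hK, hev⟩ := exists_xiAbsMoment_le 1
  filter_upwards [hev, tendsto_xiSaddle_atTop.eventually_ge_atTop (2 * K + 2),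
    tendsto_xiLam_atTop.eventually_ge_atTop 1] with k hk ha hl
  have hM := xiMoment_pos k
  have hsl : 1 ≤ sqrt (xiLam k) := by rwa [le_sqrt (by norm_num) (by linarith), one_pow]
  have h1 := abs_xiMean_sub_le k (xiSaddle k)
  have h2 : xiAbsMoment k 1 (xiSaddle k) / xiMoment k ≤ K := by
    rw [div_le_iff₀ hM]
    refine hk.trans ?_
    rw [pow_one]
    have : K / sqrt (xiLam k) ≤ K := div_le_self hK.le hsl
    exact mul_le_mul_of_nonneg_right this hM.le
  have := (abs_sub_le_iff.1 (h1.trans h2)).2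
  linarith

/-- **Decay of the central moments**: for every `l` there is `K'_l` with
`|m_l(k)| ≤ K'_l (√λ_k ū_k)^{-l}` for all large `k`. [folklore] -/
theorem exists_abs_xiCM_le (l : ℕ) : ∃ K : ℝ, 0 < K ∧ ∀ᶠ k : ℕ in atTop,
    |xiCM k l| ≤ K / (sqrt (xiLam k) * xiMean k) ^ l := by
  obtain ⟨Kl, hKl, hevl⟩ := exists_xiAbsMoment_le l
  obtain ⟨K1, hK1, hev1⟩ := exists_xiAbsMoment_le 1
  refine ⟨2 ^ l * (Kl + K1 ^ l), by positivity, ?_⟩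
  filter_upwards [hevl, hev1, tendsto_xiLam_atTop.eventually_ge_atTop 1] with k hkl hk1 hl
  have hM := xiMoment_pos k
  have hū := xiMean_pos k
  have hsl : 0 < sqrt (xiLam k) := sqrt_pos.2 (by linarith)
  -- |a - ū| ≤ K1/√λ
  have hdist : |xiSaddle k - xiMean k| ≤ K1 / sqrt (xiLam k) := by
    rw [abs_sub_comm]
    refine (abs_xiMean_sub_le k (xiSaddle k)).trans ?_
    rw [div_le_iff₀ hM, pow_one] at *
    exact hk1
  -- J ≤ 2^l (Kl/√λ^l + (K1/√λ)^l) M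
  have hJ : xiAbsMoment k l (xiMean k) ≤
      2 ^ l * (Kl + K1 ^ l) / sqrt (xiLam k) ^ l * xiMoment k := by
    refine (xiAbsMoment_le_of_centre k l (xiSaddle k) (xiMean k)).trans ?_
    have h2 : |xiSaddle k - xiMean k| ^ l ≤ (K1 / sqrt (xiLam k)) ^ l :=
      pow_le_pow_left₀ (abs_nonneg _) hdist l
    calc 2 ^ l * (xiAbsMoment k l (xiSaddle k) + |xiSaddle k - xiMean k| ^ l * xiMoment k)
        ≤ 2 ^ l * (Kl / sqrt (xiLam k) ^ l * xiMoment k +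
            (K1 / sqrt (xiLam k)) ^ l * xiMoment k) := by
          gcongr
      _ = 2 ^ l * (Kl + K1 ^ l) / sqrt (xiLam k) ^ l * xiMoment k := by rw [div_pow]; ring
  refine (abs_xiCM_le k l).trans ?_
  rw [div_le_iff₀ (by positivity), mul_pow]
  calc xiAbsMoment k l (xiMean k) ≤ 2 ^ l * (Kl + K1 ^ l) / sqrt (xiLam k) ^ l * xiMoment k := hJ
    _ = 2 ^ l * (Kl + K1 ^ l) / (sqrt (xiLam k) ^ l * xiMean k ^ l) *
          (xiMean k ^ l * xiMoment k) := by
        field_simp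

/-- **The analytic input for GORZ Thm. 1**: the normalised central moments of `ν_k ∝ Φ(u) u^k du`
satisfy `m_l(k) = o(k^{-l/2})` for every `l ≥ 1` (the gain over `O(k^{-l/2})` is the factor
`a_k^{-l/2}`, `a_k → ∞`). [folklore] -/
theorem isLittleO_xiCM {l : ℕ} (hl : 1 ≤ l) :
    (fun k : ℕ ↦ xiCM k l) =o[atTop] fun k : ℕ ↦ (sqrt k)⁻¹ ^ l := by
  obtain ⟨K, hK, hev⟩ := exists_abs_xiCM_le l
  rw [isLittleO_iff]
  intro ε hε
  -- choose A with K (2/√A)^l ≤ ε, i.e. √A^l ≥ K 2^l/ε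
  have hA : ∀ᶠ k : ℕ in atTop, K * 2 ^ l / ε ≤ sqrt (xiSaddle k) ^ l := by
    have ht : Tendsto (fun k : ℕ ↦ sqrt (xiSaddle k) ^ l) atTop atTop :=
      (tendsto_pow_atTop (by omega)).comp (tendsto_sqrt_atTop.comp tendsto_xiSaddle_atTop)
    exact ht.eventually_ge_atTop _
  filter_upwards [hev, hA, eventually_xiSaddle_le_two_mul_xiMean, eventually_saddle_lam]
    with k hk hA' hū2 hsl
  obtain ⟨hk1, ha1, _⟩ := hsl
  have hkpos : (0:ℝ) < k := by exact_mod_cast hk1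
  have ha := xiSaddle_pos k
  have hū := xiMean_pos k
  have hsa : 0 < sqrt (xiSaddle k) := sqrt_pos.2 ha
  have hsk : 0 < sqrt (k : ℝ) := sqrt_pos.2 hkpos
  -- √λ ū ≥ √(k/a) (a/2) = √k √a / 2
  have hlam : sqrt ((k : ℝ) / xiSaddle k) ≤ sqrt (xiLam k) := sqrt_le_sqrt (div_xiSaddle_le_xiLam k)
  have hkey : sqrt (k : ℝ) * sqrt (xiSaddle k) / 2 ≤ sqrt (xiLam k) * xiMean k := by
    have h1 : sqrt ((k : ℝ) / xiSaddle k) * xiSaddle k = sqrt k * sqrt (xiSaddle k) := by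
      rw [sqrt_div hkpos.le, div_mul_eq_mul_div, mul_div_assoc, div_sqrt]
    calc sqrt (k : ℝ) * sqrt (xiSaddle k) / 2 = sqrt ((k : ℝ) / xiSaddle k) * (xiSaddle k / 2) := by
          rw [← h1]; ring
      _ ≤ sqrt (xiLam k) * xiMean k :=
          mul_le_mul hlam (by linarith) (by positivity) (sqrt_nonneg _)
  have hpow : (sqrt (k : ℝ) * sqrt (xiSaddle k) / 2) ^ l ≤ (sqrt (xiLam k) * xiMean k) ^ l :=
    pow_le_pow_left₀ (by positivity) hkey l
  rw [Real.norm_eq_abs, Real.norm_eq_abs,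
    abs_of_nonneg (by positivity : (0 : ℝ) ≤ (sqrt (k : ℝ))⁻¹ ^ l)]
  calc |xiCM k l| ≤ K / (sqrt (xiLam k) * xiMean k) ^ l := hk
    _ ≤ K / (sqrt (k : ℝ) * sqrt (xiSaddle k) / 2) ^ l :=
        div_le_div_of_nonneg_left hK.le (by positivity) hpow
    _ = (K * 2 ^ l / sqrt (xiSaddle k) ^ l) * (sqrt (k : ℝ))⁻¹ ^ l := by
        rw [inv_pow, div_pow, mul_pow]; field_simp
    _ ≤ ε * (sqrt (k : ℝ))⁻¹ ^ l := by
        apply mul_le_mul_of_nonneg_right _ (by positivity)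
        rw [div_le_iff₀ (by positivity)]
        rw [div_le_iff₀ hε] at hA'
        linarith [hA']

end Literature.NumberTheory.LFunctions

end
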